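import Summits.FinalStateConjecture.FinalStateConjecture.Theorems.EIHFluxBalanceInertialRecessionStubQuasiStationarityStabiliser

/-!
# Route EIHFluxBalance — `InertialRecession`, line `sublinear-is-free-clean-window-charges`,
# stub `stub_quasiStationarity`: reduction of `so(1,3)` modulo the Kerr–Schild stabiliser

Helper file (part 3 of the kinematic reduction of the stub `stub_quasiStationarity` of the crux
`stmt-FinalStateConjecture-10166`). For an `η`-antisymmetric operator `ω` on `E4` (an element of
`so(1,3)`, e.g. the body-frame rate `Λ⁻¹Λ̇` of a Lorentz motion) we subtract its component along
the infinitesimal stabiliser of the Kerr–Schild form and bound what is left ENTRYWISE by the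
columns `ω e₀` (the rest-frame acceleration `Λ⁻¹ u̇`) and `ω e₃` (the rest-frame spin-axis rate):

* `norm_sub_spinStab_apply_le` : `‖(ω − ω₂₁ J12) v‖ ≤ 3 (‖ω e₀‖ + ‖ω e₃‖) ‖v‖` (spinning case:
  stabiliser `so(2)` about `e₃`);
* `norm_sub_rotStab_apply_le` : `‖(ω − ω₂₁ J12 − ω₃₂ J23 − ω₁₃ J31) v‖ ≤ 4 ‖ω e₀‖ ‖v‖`
  (Schwarzschild case: stabiliser `so(3)`).

Pure linear algebra of `so(1,3) = boosts ⊕ so(3)` in the basis `e₀, …, e₃` (O'Neill 1983, Ch. 9).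
-/

noncomputable section

namespace Summit.FinalStateConjecture.FinalStateConjecture.Theorems.SublinearIsFree.QuasiStationarity

open scoped BigOperators Topology
open Filter Set Function Literature.Geometry.Lorentzian
open Summit.FinalStateConjecture.FinalStateConjecture.Theorems
open Summit.FinalStateConjecture.FinalStateConjecture.Theorems.InertialRecession.Negative

/-- Componentwise extensionality on `E4`. [folklore] -/
private theorem ext4' {v w : E4} (h0 : v 0 = w 0) (h1 : v 1 = w 1) (h2 : v 2 = w 2)
    (h3 : v 3 = w 3) : v = w := by
  ext k
  fin_cases k <;> assumption

/-- Expansion of a vector of `E4` in the coordinate basis. [folklore] -/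
theorem eq_sum_basisVector (v : E4) :
    v = v 0 • E4.basisVector 0 + v 1 • E4.basisVector 1 + v 2 • E4.basisVector 2 +
      v 3 • E4.basisVector 3 := by
  refine ext4' ?_ ?_ ?_ ?_ <;> simp

/-- Components are bounded by the Euclidean norm. [folklore] -/
theorem abs_apply_le_norm (v : E4) (μ : Fin 4) : |v μ| ≤ ‖v‖ := by
  rw [← Real.norm_eq_abs]
  exact PiLp.norm_apply_le v μ

/-- **Operator bound from the images of the basis vectors**: if `‖T e_μ‖ ≤ c_μ` then
`‖T v‖ ≤ (c₀ + c₁ + c₂ + c₃) ‖v‖`. [folklore] -/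
theorem norm_apply_le_of_basisVector (T : E4 →L[ℝ] E4) {c₀ c₁ c₂ c₃ : ℝ}
    (h0 : ‖T (E4.basisVector 0)‖ ≤ c₀) (h1 : ‖T (E4.basisVector 1)‖ ≤ c₁)
    (h2 : ‖T (E4.basisVector 2)‖ ≤ c₂) (h3 : ‖T (E4.basisVector 3)‖ ≤ c₃) (v : E4) :
    ‖T v‖ ≤ (c₀ + c₁ + c₂ + c₃) * ‖v‖ := by
  have hc := abs_apply_le_norm v
  have hv0 : 0 ≤ ‖v‖ := norm_nonneg v
  calc ‖T v‖ = ‖v 0 • T (E4.basisVector 0) + v 1 • T (E4.basisVector 1) +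
        v 2 • T (E4.basisVector 2) + v 3 • T (E4.basisVector 3)‖ := by
        conv_lhs => rw [eq_sum_basisVector v]
        simp only [map_add, map_smul]
    _ ≤ ‖v 0 • T (E4.basisVector 0)‖ + ‖v 1 • T (E4.basisVector 1)‖ +
        ‖v 2 • T (E4.basisVector 2)‖ + ‖v 3 • T (E4.basisVector 3)‖ :=
        by
        refine (norm_add_le _ _).trans ?_
        gcongr
        exact norm_add₃_le
    _ = |v 0| * ‖T (E4.basisVector 0)‖ + |v 1| * ‖T (E4.basisVector 1)‖ +
        |v 2| * ‖T (E4.basisVector 2)‖ + |v 3| * ‖T (E4.basisVector 3)‖ := by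
        simp only [norm_smul, Real.norm_eq_abs]
    _ ≤ ‖v‖ * c₀ + ‖v‖ * c₁ + ‖v‖ * c₂ + ‖v‖ * c₃ :=
        add_le_add (add_le_add (add_le_add
          (mul_le_mul (hc 0) h0 (norm_nonneg _) hv0) (mul_le_mul (hc 1) h1 (norm_nonneg _) hv0))
          (mul_le_mul (hc 2) h2 (norm_nonneg _) hv0)) (mul_le_mul (hc 3) h3 (norm_nonneg _) hv0)
    _ = (c₀ + c₁ + c₂ + c₃) * ‖v‖ := by ring

/-- `‖a e₀ + b e₃‖ ≤ |a| + |b|` (triangle inequality with unit basis vectors). [folklore] -/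
theorem norm_smul_add_smul_basisVector_le (a b : ℝ) (μ ν : Fin 4) :
    ‖a • E4.basisVector μ + b • E4.basisVector ν‖ ≤ |a| + |b| := by
  refine (norm_add_le _ _).trans ?_
  simp [norm_smul]

/-- **The component relations of `so(1,3)`**: for `η`-antisymmetric `ω`, the matrix
`Ω_{μν} = (ω e_ν)_μ` has `Ω₀ᵢ = Ωᵢ₀`, `Ωᵢᵢ = 0`, `Ωᵢⱼ = −Ωⱼᵢ` (`i, j` spatial)
(O'Neill 1983, Ch. 9). [folklore] -/
theorem so13_components (S : E4 →L[ℝ] E4)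
    (hS : ∀ v w, Minkowski.bilin (S v) w + Minkowski.bilin v (S w) = 0) :
    S (E4.basisVector 1) 1 = 0 ∧ S (E4.basisVector 2) 2 = 0 ∧ S (E4.basisVector 3) 3 = 0 ∧
    S (E4.basisVector 1) 0 = S (E4.basisVector 0) 1 ∧
    S (E4.basisVector 2) 0 = S (E4.basisVector 0) 2 ∧
    S (E4.basisVector 3) 0 = S (E4.basisVector 0) 3 ∧
    S (E4.basisVector 2) 1 = -S (E4.basisVector 1) 2 ∧
    S (E4.basisVector 1) 3 = -S (E4.basisVector 3) 1 ∧
    S (E4.basisVector 2) 3 = -S (E4.basisVector 3) 2 := by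
  have rel : ∀ μ ν : Fin 4, -(S (E4.basisVector μ) 0 * (if ν = 0 then (1 : ℝ) else 0)) +
      S (E4.basisVector μ) 1 * (if ν = 1 then (1 : ℝ) else 0) +
      S (E4.basisVector μ) 2 * (if ν = 2 then (1 : ℝ) else 0) +
      S (E4.basisVector μ) 3 * (if ν = 3 then (1 : ℝ) else 0) +
      (-((if μ = 0 then (1 : ℝ) else 0) * S (E4.basisVector ν) 0) +
      (if μ = 1 then (1 : ℝ) else 0) * S (E4.basisVector ν) 1 +
      (if μ = 2 then (1 : ℝ) else 0) * S (E4.basisVector ν) 2 +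
      (if μ = 3 then (1 : ℝ) else 0) * S (E4.basisVector ν) 3) = 0 := fun μ ν ↦ by
    have h := hS (E4.basisVector μ) (E4.basisVector ν)
    rw [minkowski_components, minkowski_components] at h
    simpa only [E4.basisVector, PiLp.single_apply, eq_comm] using h
  have r11 := rel 1 1; have r22 := rel 2 2; have r33 := rel 3 3
  have r01 := rel 0 1; have r02 := rel 0 2; have r03 := rel 0 3
  have r12 := rel 1 2; have r13 := rel 1 3; have r23 := rel 2 3
  simp only [Fin.isValue, Fin.reduceEq, if_true, if_false, mul_one, mul_zero, one_mul, zero_mul,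
    add_zero, zero_add, neg_zero] at r11 r22 r33 r01 r02 r03 r12 r13 r23
  refine ⟨by linarith, by linarith, by linarith, by linarith, by linarith, by linarith, by linarith,
    by linarith, by linarith⟩

/-- **Reduction modulo the spin-axis stabiliser.** For `η`-antisymmetric `ω`, subtracting the
rotation component `ω₂₁ J12` about `e₃` leaves an operator whose columns are built from the
entries of `ω e₀` and `ω e₃` only: `‖(ω − ω₂₁ J12) v‖ ≤ 3 (‖ω e₀‖ + ‖ω e₃‖) ‖v‖`. [folklore] -/
theorem norm_sub_spinStab_apply_le (S : E4 →L[ℝ] E4)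
    (hS : ∀ v w, Minkowski.bilin (S v) w + Minkowski.bilin v (S w) = 0) (v : E4) :
    ‖(S - (S (E4.basisVector 1) 2) • J12) v‖ ≤
      3 * (‖S (E4.basisVector 0)‖ + ‖S (E4.basisVector 3)‖) * ‖v‖ := by
  obtain ⟨c11, c22, -, c10, c20, -, c21, c13, c23⟩ := so13_components S hS
  set T : E4 →L[ℝ] E4 := S - (S (E4.basisVector 1) 2) • J12 with hT
  set n0 := ‖S (E4.basisVector 0)‖
  set n3 := ‖S (E4.basisVector 3)‖
  have hTapp : ∀ u : E4, T u = S u - (S (E4.basisVector 1) 2) • J12 u := fun u ↦ by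
    simp [hT, sub_apply]
  -- images of the basis vectors
  have hX0 : T (E4.basisVector 0) = S (E4.basisVector 0) := by
    rw [hTapp, (rotGen_props J12 (Or.inl rfl)).2.2, smul_zero, sub_zero]
  have hJ3 : J12 (E4.basisVector 3) = 0 := by
    refine ext4' ?_ ?_ ?_ ?_ <;>
      simp [(J12_apply _).1, (J12_apply _).2.1, (J12_apply _).2.2.1, (J12_apply _).2.2.2]
  have hX3 : T (E4.basisVector 3) = S (E4.basisVector 3) := by
    rw [hTapp, hJ3, smul_zero, sub_zero]
  have hX1 : T (E4.basisVector 1) =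
      S (E4.basisVector 0) 1 • E4.basisVector 0 + S (E4.basisVector 1) 3 • E4.basisVector 3 := by
    rw [hTapp]
    refine ext4' ?_ ?_ ?_ ?_ <;>
      simp [(J12_apply _).1, (J12_apply _).2.1, (J12_apply _).2.2.1, (J12_apply _).2.2.2,
        c11, c10]
  have hX2 : T (E4.basisVector 2) =
      S (E4.basisVector 0) 2 • E4.basisVector 0 + S (E4.basisVector 2) 3 • E4.basisVector 3 := by
    rw [hTapp]
    refine ext4' ?_ ?_ ?_ ?_ <;>
      simp [(J12_apply _).1, (J12_apply _).2.1, (J12_apply _).2.2.1, (J12_apply _).2.2.2,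
        c22, c20, c21]
  -- norms of the images
  have h0 : ‖T (E4.basisVector 0)‖ ≤ n0 := by rw [hX0]
  have h3 : ‖T (E4.basisVector 3)‖ ≤ n3 := by rw [hX3]
  have h1 : ‖T (E4.basisVector 1)‖ ≤ n0 + n3 := by
    rw [hX1]
    refine (norm_smul_add_smul_basisVector_le _ _ _ _).trans (add_le_add ?_ ?_)
    · exact abs_apply_le_norm _ 1
    · rw [c13, abs_neg]; exact abs_apply_le_norm _ 1
  have h2 : ‖T (E4.basisVector 2)‖ ≤ n0 + n3 := by
    rw [hX2]
    refine (norm_smul_add_smul_basisVector_le _ _ _ _).trans (add_le_add ?_ ?_)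
    · exact abs_apply_le_norm _ 2
    · rw [c23, abs_neg]; exact abs_apply_le_norm _ 2
  have key := norm_apply_le_of_basisVector T h0 h1 h2 h3 v
  have hn0 : 0 ≤ n0 := norm_nonneg _
  have hn3 : 0 ≤ n3 := norm_nonneg _
  calc ‖T v‖ ≤ (n0 + (n0 + n3) + (n0 + n3) + n3) * ‖v‖ := key
    _ ≤ 3 * (n0 + n3) * ‖v‖ := by nlinarith [norm_nonneg v]

/-- **Reduction modulo the full rotation stabiliser (Schwarzschild case).** For `η`-antisymmetric
`ω`, subtracting its rotation part `ω₂₁ J12 + ω₃₂ J23 + ω₁₃ J31` leaves the infinitesimal boost,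
whose entries are those of `ω e₀`: `‖(ω − ω₂₁ J12 − ω₃₂ J23 − ω₁₃ J31) v‖ ≤ 4 ‖ω e₀‖ ‖v‖`.
[folklore] -/
theorem norm_sub_rotStab_apply_le (S : E4 →L[ℝ] E4)
    (hS : ∀ v w, Minkowski.bilin (S v) w + Minkowski.bilin v (S w) = 0) (v : E4) :
    ‖(S - ((S (E4.basisVector 1) 2) • J12 + (S (E4.basisVector 2) 3) • J23 +
        (S (E4.basisVector 3) 1) • J31)) v‖ ≤ 4 * ‖S (E4.basisVector 0)‖ * ‖v‖ := by
  obtain ⟨c11, c22, c33, c10, c20, c30, c21, c13, c23⟩ := so13_components S hS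
  set T : E4 →L[ℝ] E4 := S - ((S (E4.basisVector 1) 2) • J12 + (S (E4.basisVector 2) 3) • J23 +
    (S (E4.basisVector 3) 1) • J31) with hT
  set n0 := ‖S (E4.basisVector 0)‖
  have hTapp : ∀ u : E4, T u = S u - ((S (E4.basisVector 1) 2) • J12 u +
      (S (E4.basisVector 2) 3) • J23 u + (S (E4.basisVector 3) 1) • J31 u) := fun u ↦ by
    simp [hT, sub_apply, add_apply]
  have hX0 : T (E4.basisVector 0) = S (E4.basisVector 0) := by
    rw [hTapp]
    refine ext4' ?_ ?_ ?_ ?_ <;>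
      simp [(J12_apply _).1, (J12_apply _).2.1, (J12_apply _).2.2.1, (J12_apply _).2.2.2,
        (J23_apply _).1, (J23_apply _).2.1, (J23_apply _).2.2.1, (J23_apply _).2.2.2,
        (J31_apply _).1, (J31_apply _).2.1, (J31_apply _).2.2.1, (J31_apply _).2.2.2]
  have hX1 : T (E4.basisVector 1) = S (E4.basisVector 0) 1 • E4.basisVector 0 := by
    rw [hTapp]
    refine ext4' ?_ ?_ ?_ ?_ <;>
      simp [(J12_apply _).1, (J12_apply _).2.1, (J12_apply _).2.2.1, (J12_apply _).2.2.2,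
        (J23_apply _).1, (J23_apply _).2.1, (J23_apply _).2.2.1, (J23_apply _).2.2.2,
        (J31_apply _).1, (J31_apply _).2.1, (J31_apply _).2.2.1, (J31_apply _).2.2.2,
        c11, c10, c13]
  have hX2 : T (E4.basisVector 2) = S (E4.basisVector 0) 2 • E4.basisVector 0 := by
    rw [hTapp]
    refine ext4' ?_ ?_ ?_ ?_ <;>
      simp [(J12_apply _).1, (J12_apply _).2.1, (J12_apply _).2.2.1, (J12_apply _).2.2.2,
        (J23_apply _).1, (J23_apply _).2.1, (J23_apply _).2.2.1, (J23_apply _).2.2.2,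
        (J31_apply _).1, (J31_apply _).2.1, (J31_apply _).2.2.1, (J31_apply _).2.2.2,
        c22, c20, c21]
  have hX3 : T (E4.basisVector 3) = S (E4.basisVector 0) 3 • E4.basisVector 0 := by
    rw [hTapp]
    refine ext4' ?_ ?_ ?_ ?_ <;>
      simp [(J12_apply _).1, (J12_apply _).2.1, (J12_apply _).2.2.1, (J12_apply _).2.2.2,
        (J23_apply _).1, (J23_apply _).2.1, (J23_apply _).2.2.1, (J23_apply _).2.2.2,
        (J31_apply _).1, (J31_apply _).2.1, (J31_apply _).2.2.1, (J31_apply _).2.2.2,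
        c33, c30, c23]
  have hsingle : ∀ (a : ℝ), ‖a • E4.basisVector (0 : Fin 4)‖ ≤ |a| := fun a ↦ by
    simp [norm_smul]
  have h0 : ‖T (E4.basisVector 0)‖ ≤ n0 := by rw [hX0]
  have h1 : ‖T (E4.basisVector 1)‖ ≤ n0 := by
    rw [hX1]; exact (hsingle _).trans (abs_apply_le_norm _ 1)
  have h2 : ‖T (E4.basisVector 2)‖ ≤ n0 := by
    rw [hX2]; exact (hsingle _).trans (abs_apply_le_norm _ 2)
  have h3 : ‖T (E4.basisVector 3)‖ ≤ n0 := by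
    rw [hX3]; exact (hsingle _).trans (abs_apply_le_norm _ 3)
  have key := norm_apply_le_of_basisVector T h0 h1 h2 h3 v
  calc ‖T v‖ ≤ (n0 + n0 + n0 + n0) * ‖v‖ := key
    _ = 4 * n0 * ‖v‖ := by ring

/-- Registered sub-goal form (stub `so13_component_relations` of the crux item) of `so13_components`:
the component relations of the Lorentz algebra `so(1,3)` (O'Neill 1983, Ch. 9). [folklore] -/
theorem so13_component_relations : open Literature.Geometry.Lorentzian Filter Topology in ∀ (S : E4 →L[ℝ] E4), (∀ v w : E4, Minkowski.bilin (S v) w + Minkowski.bilin v (S w) = 0) → S (E4.basisVector 1) 1 = 0 ∧ S (E4.basisVector 2) 2 = 0 ∧ S (E4.basisVector 3) 3 = 0 ∧ S (E4.basisVector 1) 0 = S (E4.basisVector 0) 1 ∧ S (E4.basisVector 2) 0 = S (E4.basisVector 0) 2 ∧ S (E4.basisVector 3) 0 = S (E4.basisVector 0) 3 ∧ S (E4.basisVector 2) 1 = -S (E4.basisVector 1) 2 ∧ S (E4.basisVector 1) 3 = -S (E4.basisVector 3) 1 ∧ S (E4.basisVector 2) 3 = -S (E4.basisVector 3) 2 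:=
  so13_components

end Summit.FinalStateConjecture.FinalStateConjecture.Theorems.SublinearIsFree.QuasiStationarity

end
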